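import Summits.ResolutionOfSingularities.ResolutionOfSingularities.Theses.Descent
import Summits.ResolutionOfSingularities.ResolutionOfSingularities.Theses.EscapeRate
import Summits.ResolutionOfSingularities.ResolutionOfSingularities.Theses.RadicialJung
import Summits.ResolutionOfSingularities.ResolutionOfSingularities.Theorems.RadicialJungCleanModelsSuffice
import Literature.AlgebraicGeometry.Resolution.LogRegularResolutionGeneralHolds
import Summits.ResolutionOfSingularities.ResolutionOfSingularities.Theorems.RadicialJungCleanModelsSufficeFrame
import Summits.ResolutionOfSingularities.ResolutionOfSingularities.Theorems.WeightedInvariantDescentPerfectToAllPicoverLink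
import HarnessLib

/-!
# Crux `DescentPerfectToAll` (stmt-ResolutionOfSingularities-0549): the line `via-clean-models` —
# `RadicialJung.CleanModels → Picover → DescentPerfectToAll`, sorry-free

After 2026-08-27 the tree PROVES (i) Kato 1994 (10.4) in both renderings
(`Kato1994_logRegular_hasResolution_general_holds`, `Kato1994_logRegularScheme_hasResolution_holds`) and hence
(ii) `RadicialJung.CleanResolves` (stmt-16286, `Theorems.cleanResolves_proof`: a POINTWISE log-clean proper
birational regular model of a degree-`p` purely inseparable class resolves the normalisation — the
exceptionalisation game of `Theorems.RadicialJung.CleanModelsSuffice` supplies the boundary compatibility that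
the pointwise statement lacks, then Kato's fan subdivision resolves the log-regular `LogAtlas`).  Consequently
the research content needed by crux 0549 along the Jung/Giraud family of lines SHRINKS to the pointwise
statement `RadicialJung.CleanModels` (crux stmt-ResolutionOfSingularities-15917): no snc boundary, no uniform
sections, no chart-compatibility rider (contrast `WildQuotients.GiraudNormalFormSep`, stmt-18001, and the
rider `stub_cleanModelsR` of the line `via_picover_jung`).

* `picover_of_cleanModels` — `RadicialJung.CleanModels → PAlteration.Picover`: pointwise clean model +
  `cleanResolves_proof` give the degree-`p` residue `HasResolution (normalizationIn W L)`; the per-prime frame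
  `RadicialJung.CleanModelsSuffice.picoverAt_of_degPAt` (Temkin's degree-`p` tower + `Y^{K(X)} → X`) gives
  `Picover` at `p`.
* `descentPerfectToAll_of_cleanModels` — `RadicialJung.CleanModels → Descent.DescentPerfectToAll` through
  `descentPerfectToAll_of_picover` (p113743), and the `EscapeRate` copy.

Nothing here is new mathematics: cruxes 0549, 0554 and 15917 remain open; this file records that 15917 ALONE
now implies the other two.
-/

noncomputable section

set_option linter.dupNamespace false -- mandated namespace of this single-conjunct summit

open CategoryTheory AlgebraicGeometry
open Literature.AlgebraicGeometry.Resolution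

namespace Summit.ResolutionOfSingularities.ResolutionOfSingularities.Theorems

/-- **`CleanModels ⇒ Picover`** (crux stmt-15917 of route RadicialJung implies crux stmt-0554 of route
pAlteration), unconditionally: for each prime `p`, a pointwise log-clean proper birational regular model
(`CleanModels` at `p`) of every degree-`p` purely inseparable class resolves the normalisation of the base in the
extension (`cleanResolves_proof`, via the exceptionalisation game and Kato 1994 (10.4)); Temkin's degree-`p` tower
(`RadicialJung.CleanModelsSuffice.picoverAt_of_degPAt`) turns this degree-`p` residue into `Picover` at `p`.
[folklore] -/
theorem picover_of_cleanModels
    (hCM : Summit.ResolutionOfSingularities.ResolutionOfSingularities.Theses.RadicialJung.CleanModels) :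
    Summit.ResolutionOfSingularities.ResolutionOfSingularities.Theses.PAlteration.Picover := by
  intro p hp k _ _ Y X f g hsep hlft hqc hY hYreg hX hfin hui hsurj
  have hDegP : ∀ (k : Type) [Field k] [CharP k p] (W : Scheme.{0}) [IsIntegral W]
      (f : W ⟶ Spec (.of k)) (L : Type) [Field L] [Algebra W.functionField L],
      IsSeparated f → LocallyOfFiniteType f → QuasiCompact f → Scheme.IsRegular W →
      IsPurelyInseparable W.functionField L → Module.finrank W.functionField L = p →
      Scheme.HasResolution (normalizationIn W L) := by
    -- `CleanResolves` (stmt-16286; = `Theorems.cleanResolves_proof`, re-derived here from the built modules: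
    -- the `π = 𝟙` case by the exceptionalisation game + Kato (10.4), then `cleanResolves_of_self`)
    have hCR : Summit.ResolutionOfSingularities.ResolutionOfSingularities.Theses.RadicialJung.CleanResolves := by
      refine RadicialJung.CleanResolves.cleanResolves_of_self ?_
      intro p hp k _ _ V _ f L _ _ hsep hloc hqc hVreg hPI hdeg hclean
      haveI := hsep; haveI := hloc; haveI := hqc; haveI := hPI
      obtain ⟨V', hV'int, π', hdom, hprop, hbir, S, hend⟩ :=
        RadicialJung.CleanModelsSuffice.endState_exists p hp k V f L hVreg hdeg hclean
      haveI := hV'int; haveI := hdom; haveI := hprop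
      exact RadicialJung.CleanModelsSuffice.stub_gameEndResolves
        Kato1994_logRegularScheme_hasResolution_holds.{0} p hp k V f L hdeg V' π' hbir S hend
    intro k _ _ W _ f L _ _ hs hl hq hr hpi hd
    obtain ⟨V, π, hVi, hdom, hV⟩ := hCM p hp k W f L hs hl hq hr hpi hd
    exact hCR p hp k W f L hs hl hq hr hpi hd V π hV
  exact RadicialJung.CleanModelsSuffice.picoverAt_of_degPAt p hp hDegP k Y X f g hsep hlft hqc hY
    hYreg hX hfin hui hsurj

/-- **`CleanModels ⇒ DescentPerfectToAll`** (crux stmt-15917 ⇒ crux stmt-0549, the route's own decl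
`Descent.DescentPerfectToAll`): `CleanModels ⇒ Picover` (above) ⇒ the crux (`descentPerfectToAll_of_picover`:
robust separable model, iterated one-root reduction, `Picover` as the radicial bottom). [folklore] -/
theorem descentPerfectToAll_of_cleanModels
    (hCM : Summit.ResolutionOfSingularities.ResolutionOfSingularities.Theses.RadicialJung.CleanModels) :
    Summit.ResolutionOfSingularities.ResolutionOfSingularities.Theses.Descent.DescentPerfectToAll :=
  fun p hp H => descentPerfectToAll_of_picover (picover_of_cleanModels hCM) p hp H

/-- Same implication, concluding the `EscapeRate` copy of the crux (the bet route of the registered 0549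
skeletons). [folklore] -/
theorem escapeRate_descentPerfectToAll_of_cleanModels
    (hCM : Summit.ResolutionOfSingularities.ResolutionOfSingularities.Theses.RadicialJung.CleanModels) :
    Summit.ResolutionOfSingularities.ResolutionOfSingularities.Theses.EscapeRate.DescentPerfectToAll :=
  fun p hp H => descentPerfectToAll_of_picover (picover_of_cleanModels hCM) p hp H

end Summit.ResolutionOfSingularities.ResolutionOfSingularities.Theorems

end
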